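import Mathlib.Tactic.LinearCombination
import Mathlib.Tactic.Abel
import Literature.Combinatorics.Additive.TripleProductProperty
import Summits.MatrixMultiplication.OmegaCensus.DihedralLikeTPPBound
import Summits.MatrixMultiplication.OmegaCensus.DihedralLikeLaw
import HarnessLib

/-!
# The index-3 family: `β(G) = 4|G|/3` exactly for every generalized dihedral / dicyclic group with `3 ∣ |G|/2`

ω-census, family (b3).  Framing: lottery ticket; floor = certified bounds/negative ranges.

Let `G = ρ(A) ⊔ τ(A)` have a dihedral-like presentation over the finite abelian group `A` and let `φ : A →+ ZMod 3` be a
surjective-enough homomorphism (some `d` with `φ d ≠ 0`; kernel `H` of index `3`).  Then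
`S = {ρ0, τ0}`, `T = {ρ0, τd}`, `U = ρ(H) ∪ τ(2d + H)` is a TPP triple (`dihedralLike_family_tpp`) of volume `8|H|`; when
`|A| = 3|H|` this equals `4⌊2|A|/3⌋`, the kernel upper bound of `DihedralLikeLaw.lean`, so `β(G) = 8|A|/3` exactly
(`dihedralLike_law_exact`).  This is the common generalization of the dihedral family `({1,s},{1,sr},⟨r³⟩ ∪ sr²⟨r³⟩)`
(gen 1) and the dicyclic family (`DicyclicTPPFamily.lean`), and covers e.g. `Dih(ℤ₃²)`, `Dih(ℤ₃ × ℤ₆)`, `Dih(ℤ₂ × ℤ₆)` of the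
census's Conjecture′ table.  Proof of the TPP: 64 membership cases; the legitimate ones are abelian-group identities, the
others map under `φ` to `k·φ(d) = 0`, `k ∈ {±1,±2}`, impossible in `ZMod 3`.
-/

namespace Summit.MatrixMultiplication.OmegaCensus

open Literature.Combinatorics.Additive Finset

section Family

variable {A : Type*} [AddCommGroup A] [Fintype A] {G : Type} [Group G] [DecidableEq G]
  {ρ τ : A → G} {c₀ : A}

omit [Fintype A] [DecidableEq G] in
/-- In a dihedral-like presentation `2c₀ = 0` (associativity of `τ0·τ0·τ0`). [folklore] -/
theorem two_c0_eq_zero (hρτ : ∀ a b, ρ a * τ b = τ (b - a))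
    (hτρ : ∀ a b, τ a * ρ b = τ (a + b)) (hττ : ∀ a b, τ a * τ b = ρ (c₀ + b - a)) (hτ : Function.Injective τ) :
    c₀ + c₀ = 0 := by
  have h1 : τ 0 * τ 0 * τ 0 = τ (-c₀ : A) := by rw [hττ, hρτ]; congr 1; abel
  have h2 : τ 0 * (τ 0 * τ 0) = τ (c₀ : A) := by rw [hττ, hτρ]; congr 1; abel
  have := hτ (h1.symm.trans ((mul_assoc _ _ _).trans h2))
  linear_combination (norm := abel1) -this

/-- **The index-3 TPP family.** [folklore] -/
theorem dihedralLike_family_tpp (hρρ : ∀ a b, ρ a * ρ b = ρ (a + b)) (hρτ : ∀ a b, ρ a * τ b = τ (b - a))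
    (hτρ : ∀ a b, τ a * ρ b = τ (a + b)) (hττ : ∀ a b, τ a * τ b = ρ (c₀ + b - a))
    (hρ : Function.Injective ρ) (hτ : Function.Injective τ) (hne : ∀ a b, ρ a ≠ τ b)
    (φ : A →+ ZMod 3) (d : A) (hd : φ d ≠ 0) :
    TripleProductProperty ({ρ 0, τ 0} : Finset G) ({ρ 0, τ d} : Finset G)
      (((univ.filter fun a : A => φ a = 0).image ρ) ∪
        ((univ.filter fun a : A => φ a = 0).image fun a => τ (d + d + a))) := by
  have h2c := two_c0_eq_zero hρτ hτρ hττ hτ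
  have hφc : φ c₀ = 0 := by
    have h3 : (3 : ZMod 3) = 0 := by decide
    have : φ (c₀ + c₀) = 0 := by rw [h2c, map_zero]
    rw [map_add] at this
    have e : φ c₀ = 3 * φ c₀ - (φ c₀ + φ c₀) := by ring
    rw [e, this, h3]; ring
  have invρ := inv_rho hρρ
  have invτ := inv_tau hρρ hττ
  have one_eq : (1 : G) = ρ 0 := (rho_zero hρρ).symm
  intro s hs s' hs' t ht t' ht' u hu u' hu' heq
  simp only [mem_insert, mem_singleton, mem_union, mem_image, mem_filter, mem_univ, true_and] at hs hs' ht ht' hu hu'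
  rcases hu with ⟨h, hh, rfl⟩ | ⟨h, hh, rfl⟩ <;> rcases hu' with ⟨h', hh', rfl⟩ | ⟨h', hh', rfl⟩ <;>
  rcases hs with rfl | rfl <;> rcases hs' with rfl | rfl <;> rcases ht with rfl | rfl <;> rcases ht' with rfl | rfl <;>
  simp only [invρ, invτ, hρρ, hρτ, hτρ, hττ, one_eq] at heq <;>
  first
  | exact absurd heq.symm (hne _ _)
  | (have heq' := hρ heq
     first
     | (refine ⟨rfl, rfl, ?_⟩
        first
        | rfl
        | (congr 1; linear_combination (norm := abel1) heq')
        | (congr 1; linear_combination (norm := abel1) -heq'))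
     | (exfalso
        have hφ := congrArg φ heq'
        simp only [map_add, map_sub, map_neg, map_zero, hφc, hh, hh'] at hφ
        revert hφ hd
        generalize φ d = z
        revert z
        decide))

/-- The kernel of a homomorphism `φ : A →+ ZMod 3` taking a non-zero value has exactly `|A|/3` elements:
`3 |ker φ| = |A|` (the three fibres are translates of the kernel). [folklore] -/
theorem three_mul_card_ker [DecidableEq A] (φ : A →+ ZMod 3) (d : A) (hd : φ d ≠ 0) :
    3 * (univ.filter fun a : A => φ a = 0).card = Fintype.card A := by
  -- translation by `e` maps the fibre over `0` onto the fibre over `φ e`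
  have fib : ∀ e : A, (univ.filter fun a : A => φ a = φ e).card = (univ.filter fun a : A => φ a = 0).card := by
    intro e
    refine card_bij' (fun a _ => a - e) (fun a _ => a + e) ?_ ?_ ?_ ?_ <;> intro a ha <;>
      simp only [mem_filter, mem_univ, true_and, map_sub, map_add] at ha ⊢
    · rw [ha, sub_self]
    · rw [ha, zero_add]
    · exact sub_add_cancel a e
    · exact add_sub_cancel_right a e
  -- the values `0, φ d, φ (d + d)` are the three elements of `ZMod 3`
  have hvals : ∀ c : ZMod 3, c = 0 ∨ c = φ d ∨ c = φ (d + d) := by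
    rw [map_add]; revert hd; generalize φ d = z; revert z; decide
  have hsplit : (univ : Finset A) = (univ.filter fun a : A => φ a = 0) ∪ (univ.filter fun a : A => φ a = φ d) ∪
      (univ.filter fun a : A => φ a = φ (d + d)) := by
    ext a
    simp only [mem_univ, mem_union, mem_filter, true_and, true_iff]
    exact or_assoc.mpr (hvals (φ a))
  have hd1 : φ d ≠ φ (d + d) := by rw [map_add]; revert hd; generalize φ d = z; revert z; decide
  have hd2 : (0 : ZMod 3) ≠ φ (d + d) := by rw [map_add]; revert hd; generalize φ d = z; revert z; decide
  have d01 : Disjoint (univ.filter fun a : A => φ a = 0) (univ.filter fun a : A => φ a = φ d) :=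
    disjoint_filter.2 fun a _ h0 h1 => hd (h1.symm.trans h0)
  have d02 : Disjoint (univ.filter fun a : A => φ a = 0) (univ.filter fun a : A => φ a = φ (d + d)) :=
    disjoint_filter.2 fun a _ h0 h2 => hd2 (h0.symm.trans h2)
  have d12 : Disjoint (univ.filter fun a : A => φ a = φ d) (univ.filter fun a : A => φ a = φ (d + d)) :=
    disjoint_filter.2 fun a _ h1 h2 => hd1 (h1.symm.trans h2)
  have := congrArg Finset.card hsplit
  rw [card_univ, card_union_of_disjoint (disjoint_union_left.2 ⟨d02, d12⟩), card_union_of_disjoint d01, fib d,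
    fib (d + d)] at this
  omega

/-- **Exact law on the inverting class when `3 ∣ |A|`** (witnessed by a homomorphism `φ : A →+ ZMod 3` with a non-zero
value): every TPP triple has `|S||T||U| ≤ 4⌊2|A|/3⌋ = 8|A|/3` (`DihedralLikeLaw.lean`) and the index-3 family attains it,
so `β(G) = 4|G|/3` exactly. Covers `D_{6m}`, `Q_{12m}`, `Dih(ℤ₃²)`, `Dih(ℤ₃ × ℤ₆)`, `Dih(ℤ₂ × ℤ₆)`, … [folklore] -/
theorem dihedralLike_law_exact [DecidableEq A] [Fintype G] (hρρ : ∀ a b, ρ a * ρ b = ρ (a + b))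
    (hρτ : ∀ a b, ρ a * τ b = τ (b - a)) (hτρ : ∀ a b, τ a * ρ b = τ (a + b))
    (hττ : ∀ a b, τ a * τ b = ρ (c₀ + b - a)) (hρ : Function.Injective ρ) (hτ : Function.Injective τ)
    (hne : ∀ a b, ρ a ≠ τ b) (hsurj : ∀ g, (∃ a, ρ a = g) ∨ (∃ a, τ a = g))
    (φ : A →+ ZMod 3) (d : A) (hd : φ d ≠ 0) :
    (∀ S T U : Finset G, TripleProductProperty S T U → S.card * T.card * U.card ≤ 4 * (2 * Fintype.card A / 3)) ∧
    ∃ S T U : Finset G, TripleProductProperty S T U ∧ S.card * T.card * U.card = 4 * (2 * Fintype.card A / 3) := by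
  have hA3 := three_mul_card_ker φ d hd
  have hApos : 0 < Fintype.card A := Fintype.card_pos
  refine ⟨fun S T U h => tpp_volume_le_law_dihedralLike hρρ hρτ hτρ hττ hρ hτ hne hsurj (by omega) h, ?_⟩
  refine ⟨_, _, _, dihedralLike_family_tpp hρρ hρτ hτρ hττ hρ hτ hne φ d hd, ?_⟩
  have hS : ({ρ 0, τ 0} : Finset G).card = 2 := by
    rw [card_insert_of_notMem (by rw [mem_singleton]; exact hne 0 0), card_singleton]
  have hT : ({ρ 0, τ d} : Finset G).card = 2 := by
    rw [card_insert_of_notMem (by rw [mem_singleton]; exact hne 0 d), card_singleton]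
  have hdisj : Disjoint ((univ.filter fun a : A => φ a = 0).image ρ)
      ((univ.filter fun a : A => φ a = 0).image fun a => τ (d + d + a)) := by
    rw [disjoint_left]
    intro x hx hx'
    simp only [mem_image] at hx hx'
    obtain ⟨a, -, rfl⟩ := hx
    obtain ⟨b, -, hb⟩ := hx'
    exact hne _ _ hb.symm
  have hU := card_union_of_disjoint hdisj
  rw [card_image_of_injective _ hρ, card_image_of_injective _ (fun a b hab => by simpa using hτ hab)] at hU
  rw [hS, hT, hU]
  omega

end Family

end Summit.MatrixMultiplication.OmegaCensus
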